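import Summits.CriticalPhenomena.CardyFormulaZ2.Theorems.CardyBoundaryCoulombGasRectilinearCardyClosureDefs
import Summits.CriticalPhenomena.CardyFormulaZ2.Theorems.CardyBoundaryCoulombGasRectilinearCardyStubKernelPointAsymptotics
import Summits.CriticalPhenomena.CardyFormulaZ2.Theorems.RectilinearCardy.Negative.RectilinearCardyReductions
import HarnessLib

/-!
# Stub stub_uniformiseG of line excursion-kernel-covariance (crux RectilinearCardy, stmt-CriticalPhenomena-5660): UNIFORMISATION for the Schwarz-chart class — the pointwise (sequential) closure density law implies the uniform window asymptotics.

This is a port of the landed stub `stub_uniformise` (p126966) with the Schwarz-chart data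
`g S₀ S` (a real boundary function `g`, strictly monotone on `[S₀, S] ⊇ [0, mark 3]`, agreeing with
`w ∘ ∂Ω` on `U`) passed through hypothesis and conclusion.

The registered statement: if the closure density `closureDensity R δ v` obeys the POINTWISE
(sequential) law `closureDensity/δ → C Φ_w(∂Ω(τ))` along every sequence of meshes `δ_n → 0⁺` and
boundary-row vertices `δ_n v_n → ∂Ω(τ)` (for `τ` in an admissible flat window inside `U`, off the
poles of `w`), with ONE constant `C = C(R, U, w, g, S₀, S) > 0`, then with the constant normaliser
`N δ := C` the UNIFORM window asymptotics hold: eventually as `δ → 0⁺`, for all boundary-row `v`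
within `4δ` of a window point `∂Ω(τ)`, `|closureDensity/(δ C) − Φ_w(∂Ω(τ))| ≤ ε`. Here
`Φ_w(x) = |w′(x)| (∏_{i=0,1,3} |w(x) − w(pt i)|²)^{-1/3}`.

Proof (a re-run of the assembly `kpa_eventually_window_of_normaliser` of the kernel point
asymptotics): fix `R, U, w, g, S₀, S`, take `C` from the hypothesis and `N := fun _ => C`. If the
eventual statement failed for a window `[σ, σ']` and an `ε > 0`, `Filter.frequently_iff_seq_forall`
extracts meshes `δ_n → 0⁺` with violators `v_n ∈ boundaryRow R δ_n`, `τ_n ∈ [σ, σ']`,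
`dist (δ_n v_n) (∂Ω(τ_n)) ≤ 4 δ_n`, `ε < |closureDensity/(δ_n C) − Φ_w(∂Ω(τ_n))|`. By compactness
(`isCompact_Icc.tendsto_subseq`) `τ_{φ n} → τ⋆ ∈ [σ, σ']`, so `δ v → ∂Ω(τ⋆)` along `φ`
(`kpa_tendsto_of_dist_le_mul`); the hypothesis at `τ⋆` gives `closureDensity/δ → C Φ_w(∂Ω(τ⋆))`,
i.e. `closureDensity/(δ C) → Φ_w(∂Ω(τ⋆))`, while `Φ_w(∂Ω(τ_{φ n})) → Φ_w(∂Ω(τ⋆))` by continuity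
(`kpa_tendsto_pointKernel`) — contradiction. [folklore]
-/

noncomputable section

open Set Filter Topology MeasureTheory Metric
open Literature.Probability.RandomPlanarGeometry
open Literature.Probability.LatticeModels (Site meshPoint zdGraph)
open Summit.CriticalPhenomena.CardyFormulaZ2.Theorems.RectilinearCardy.Negative (IsRectilinear)

namespace Summit.CriticalPhenomena.CardyFormulaZ2.Cruxes.RectilinearCardy.ExcursionKernelCovariance

/-- **Stub stub_uniformiseG of line excursion-kernel-covariance (crux RectilinearCardy, stmt-CriticalPhenomena-5660)** (registered signature, verbatim): the pointwise (sequential) closure density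
law for the Schwarz-chart class, with one constant `C`, implies the uniform window law with the
constant normaliser `N δ := C`. Port of the landed `stub_uniformise` (p126966). [folklore] -/
theorem stub_uniformiseG :
    (∀ R : ConformalRectangle, IsRectilinear R → FlatMarks R →
        ∀ (U : Set ℂ) (w : ℂ → ℂ), IsOpen U → R.carrier ⊆ U →
          R.pt 0 ∈ U → R.pt 1 ∈ U → R.pt 3 ∈ U →
          DifferentiableOn ℂ w U → BijOn w R.carrier {z : ℂ | 0 < z.im} →
          ∀ (g : ℝ → ℝ) (S₀ S : ℝ), S₀ < 0 → R.mark 3 < S →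
            (StrictMonoOn g (Icc S₀ S) ∨ StrictAntiOn g (Icc S₀ S)) →
            (∀ t ∈ Icc S₀ S, R.boundary t ∈ U → w (R.boundary t) = g t) →
          ∃ C : ℝ, 0 < C ∧
            ∀ σ σ' : ℝ, AdmissibleRange R σ σ' → R.boundary '' Icc σ σ' ⊆ U →
              (∀ τ ∈ Icc σ σ', w (R.boundary τ) ≠ w (R.pt 0) ∧ w (R.boundary τ) ≠ w (R.pt 1) ∧
                w (R.boundary τ) ≠ w (R.pt 3)) →
              ∀ τ ∈ Icc σ σ', ∀ (δ : ℕ → ℝ), (∀ n, 0 < δ n) → Tendsto δ atTop (𝓝 0) →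
                ∀ (v : ℕ → Site 2), (∀ n, v n ∈ boundaryRow R (δ n)) →
                  Tendsto (fun n => meshPoint (δ n) (v n)) atTop (𝓝 (R.boundary τ)) →
                  Tendsto (fun n => closureDensity R (δ n) (v n) / δ n) atTop
                    (𝓝 (C * (‖deriv w (R.boundary τ)‖ *
                      (‖w (R.boundary τ) - w (R.pt 0)‖ ^ 2 * ‖w (R.boundary τ) - w (R.pt 1)‖ ^ 2 *
                          ‖w (R.boundary τ) - w (R.pt 3)‖ ^ 2) ^ (-(1 / 3 : ℝ)))))) →
      ∀ R : ConformalRectangle, IsRectilinear R → FlatMarks R →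
        ∀ (U : Set ℂ) (w : ℂ → ℂ), IsOpen U → R.carrier ⊆ U →
          R.pt 0 ∈ U → R.pt 1 ∈ U → R.pt 3 ∈ U →
          DifferentiableOn ℂ w U → BijOn w R.carrier {z : ℂ | 0 < z.im} →
          ∀ (g : ℝ → ℝ) (S₀ S : ℝ), S₀ < 0 → R.mark 3 < S →
            (StrictMonoOn g (Icc S₀ S) ∨ StrictAntiOn g (Icc S₀ S)) →
            (∀ t ∈ Icc S₀ S, R.boundary t ∈ U → w (R.boundary t) = g t) →
          ∃ N : ℝ → ℝ, (∀ δ, 0 < N δ) ∧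
            ∀ σ σ' : ℝ, AdmissibleRange R σ σ' → R.boundary '' Icc σ σ' ⊆ U →
              (∀ τ ∈ Icc σ σ', w (R.boundary τ) ≠ w (R.pt 0) ∧ w (R.boundary τ) ≠ w (R.pt 1) ∧
                w (R.boundary τ) ≠ w (R.pt 3)) →
              ∀ ε : ℝ, 0 < ε → ∀ᶠ δ in 𝓝[>] (0 : ℝ), ∀ v ∈ boundaryRow R δ, ∀ τ ∈ Icc σ σ',
                dist (meshPoint δ v) (R.boundary τ) ≤ 4 * δ →
                  |closureDensity R δ v / (δ * N δ) -
                      ‖deriv w (R.boundary τ)‖ *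
                        (‖w (R.boundary τ) - w (R.pt 0)‖ ^ 2 * ‖w (R.boundary τ) - w (R.pt 1)‖ ^ 2 *
                            ‖w (R.boundary τ) - w (R.pt 3)‖ ^ 2) ^ (-(1 / 3 : ℝ))| ≤ ε := by
  intro hpt R hRect hfl U w hU hRU h0U h1U h3U hw hbij g S₀ S hS₀ h3S hgm hwg
  -- the constant of the pointwise law, used as the (constant) normaliser
  obtain ⟨C, hC, hlaw⟩ := hpt R hRect hfl U w hU hRU h0U h1U h3U hw hbij g S₀ S hS₀ h3S hgm hwg
  refine ⟨fun _ => C, fun _ => hC, fun σ σ' hadm hwinU hsep ε hε => ?_⟩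
  have hgood : ∀ᶠ δ in 𝓝[>] (0 : ℝ), 0 < δ := eventually_mem_nhdsWithin.mono fun δ hδ => hδ
  by_contra hcon
  push Not at hcon
  -- a sequence of meshes with violators
  obtain ⟨δs, hδs, hbad⟩ := Filter.frequently_iff_seq_forall.1 (hcon.and_eventually hgood)
  have hδpos : ∀ n, 0 < δs n := fun n => (hbad n).2
  have hδ0 : Tendsto δs atTop (𝓝 0) := hδs.mono_right nhdsWithin_le_nhds
  choose v hv τ hτ hdist hεlt using fun n => (hbad n).1
  -- compactness of the parameter window
  obtain ⟨τ₀, hτ₀, φ, hφ, hτlim⟩ := isCompact_Icc.tendsto_subseq hτ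
  have hxU : R.boundary τ₀ ∈ U := hwinU ⟨τ₀, hτ₀, rfl⟩
  obtain ⟨hx0, hx1, hx3⟩ := hsep τ₀ hτ₀
  -- the violators converge to `x = ∂Ω(τ₀)` along the subsequence
  have hbτ : Tendsto (fun n => R.boundary (τ (φ n))) atTop (𝓝 (R.boundary τ₀)) :=
    (R.continuous_boundary.tendsto τ₀).comp hτlim
  have hax : Tendsto (fun n => meshPoint (δs (φ n)) (v (φ n))) atTop (𝓝 (R.boundary τ₀)) :=
    kpa_tendsto_of_dist_le_mul (hδ0.comp hφ.tendsto_atTop) 4 hbτ fun n => hdist (φ n)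
  -- the pointwise law at `τ₀` along the subsequence
  have hlim := hlaw σ σ' hadm hwinU hsep τ₀ hτ₀ (fun n => δs (φ n)) (fun n => hδpos (φ n))
    (hδ0.comp hφ.tendsto_atTop) (fun n => v (φ n)) (fun n => hv (φ n)) hax
  -- hence `closureDensity/(δ C)` converges to the point kernel at `x`
  have hlim' : Tendsto (fun n => closureDensity R (δs (φ n)) (v (φ n)) / (δs (φ n) * C))
      atTop (𝓝 (‖deriv w (R.boundary τ₀)‖ * (‖w (R.boundary τ₀) - w (R.pt 0)‖ ^ 2 *
        ‖w (R.boundary τ₀) - w (R.pt 1)‖ ^ 2 * ‖w (R.boundary τ₀) - w (R.pt 3)‖ ^ 2) ^ (-(1 / 3 : ℝ)))) := by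
    have h := hlim.div_const C
    rw [mul_div_cancel_left₀ _ hC.ne'] at h
    refine h.congr fun n => ?_
    rw [div_div]
  -- and the point kernel is continuous along the window: the violation is impossible
  have hΦ := kpa_tendsto_pointKernel R hU hw (τ := fun n => τ (φ n)) hτlim hxU hx0 hx1 hx3
  have hdiff := hlim'.sub hΦ
  rw [sub_self] at hdiff
  obtain ⟨n, hn⟩ := (Metric.tendsto_nhds.1 hdiff ε hε).exists
  rw [Real.dist_0_eq_abs] at hn
  exact lt_irrefl _ ((hεlt (φ n)).trans hn)

end Summit.CriticalPhenomena.CardyFormulaZ2.Cruxes.RectilinearCardy.ExcursionKernelCovariance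

end
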